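import Summits.Ventures.CertifiedArithmetic.LowPrec.RoundSqrt
import Summits.Ventures.CertifiedArithmetic.LowPrec.DoubleRoundingSqrt
import Summits.Ventures.CertifiedArithmetic.LowPrec.DoubleRoundingSqrtTables

/-!
# Double rounding of square roots — the named cells (THEOREM D-sqrt, matrix level)

HONEST FRAMING: certified error envelopes and provably optimal rounding/accumulation schemes for
low-precision formats under stated cost models; every table by two implementations; no hardware
or vendor claims.

`DRSqrt X Y` (`RoundSqrt.lean`): for every value `a ≥ 0` of `X`, ONE square root executed
(correctly rounded, `roundNESqrt`, certified against `Real.sqrt`) in `Y` and converted to `X` is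
the correctly rounded square root of `X` (saturating round-to-nearest-even, subnormals kept). This
file proves the square-root clause (S) as a statement about `DRSqrt` (`drSqrt_of_clause`, from
`drSqrt_pos` of `DoubleRoundingSqrt.lean` and the transfer lemma of `RoundSqrt.lean`) and decides
the `13 × 13` matrix of named records (`drSqrt_named_iff`: `DRSqrt X Y ↔ (X, Y) ∈ drSqrtPairs`,
`54` pairs, `41` off the diagonal):

* (S) `26` cells (`drSqrt_of_clause`): every FP4 / FP6 / FP8 record and binary16, bfloat16 →
  binary32; e2m1, e3m2, e4m3, e5m2, binary8p3 / p4 / p3f / p4f → binary16; e2m1, e3m2, e5m2,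
  binary8p3, binary8p3f → bfloat16 (`P_Y = 8 ≥ 2 P_X + 2` needs `P_X ≤ 3`);
* (G) binary8p3 → binary8p3f, binary8p4 → binary8p4f (same grid, larger top); (I) the diagonal;
* (E) `13` cells of EQUAL precision whose roots never leave the range where the two grids agree,
  innocuous although no clause applies and NINE of them are not even embeddings (e4m3 ↔ binary8p4
  ↔ binary8p4f, e5m2 ↔ binary8p3 ↔ binary8p3f minus the two (G) cells, and e3m2 → e5m2 /
  binary8p3 / binary8p3f): by exhaustion of the source format in the kernel (`drSqrtExh`) — so,
  unlike products and quotients, an innocuous square root does NOT require `F_X ⊆ F_Y`;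
* the other `115` cells FAIL, each by one kernel-evaluated witness (`drSqrtWitTable`): among the
  embedded ones e2m1 → every FP6 / FP8 record (`√3 ↦ 7/4 ↦ 2`, directly `3/2`), e3m2 / e2m3 →
  the precision-4 FP8 records (`√(7/16) ↦ 11/16 ↦ 3/4` against `5/8`; `√(7/8) ↦ 15/16 ↦ 1`
  against the subnormal `7/8` of e2m3), e2m3 → binary8p5 (`√(11/8)`) and → bfloat16 (`√(15/4)`),
  e4m3, binary8p4, binary8p4f, binary8p5 → bfloat16 and binary8p5 → binary16
  (`√(31/128) ↦ 63/128 ↦ 1/2` against `31/64`: `P_Y = 11 < 2·5 + 2`).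

§4: the binary64 record `⟨52, 1023, 2046, 2^52 - 1⟩` satisfies clause (S) against all thirteen
named records (binary32 included: `53 ≥ 2·24 + 2`). §5: the precision hypothesis is attained —
through a `P = 5 = 2 P_X + 1` record e2m1's root of `3` slips, through `P = 6` it is innocuous.

Implementation A: `code/enum/doublesqrt_decision.py` → `DOUBLE-ROUNDING-SQRT.md`,
`certs/enum/DOUBLE-ROUNDING-SQRT.json` (brute force over all `914648` nonnegative operands of the
`168` off-binary64 cells… of every cell with a source of at most 16 bits and the binary32 cells by
clause, two independent exact RNE square roots cross-checked on `142056` roundings, the surrogate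
checked against the exact root on `95228` operands, `0` disagreements with the clause; the lists
of `DoubleRoundingSqrtTables.lean` are transcribed from that certificate). PLACEMENT as in
`DoubleRoundingSqrt.lean` ([Figueroa1995]; [Roux2014, Thm 25, Rem 26, Table II]). No hardware or
vendor claims.
-/

namespace Summit.Ventures.CertifiedArithmetic

open Literature.ComputerArithmetic.FloatingPoint
open Literature.ComputerArithmetic.FloatingPoint.Format
open Literature.ComputerArithmetic.FloatingPoint.MiniFloat

/-! ## §1 The clause and the test -/

/-- THEOREM D-sqrt, THE SQUARE-ROOT CLAUSE (S), every pair of format records: `F_φ ⊆ F_ψ`,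
`P_ψ ≥ 2 P_φ + 2`, `2 (L_ψ + P_ψ - 1) ≤ L_φ`, `m_φ ≥ 1` and `L_ψ < L_φ` imply that ONE square root
of `φ`-data executed in `ψ` and converted to `φ` is the correctly rounded square root of `φ`.
[this packet; cite: Figueroa1995; Roux2014, Thm 25] -/
theorem drSqrt_of_clause {φ ψ : Format} (hE : embedsTest φ ψ = true)
    (hm : 2 * φ.manBits + 3 ≤ ψ.manBits) (hU : 2 * (ψ.qexp + ψ.manBits) ≤ φ.qexp)
    (h1 : 1 ≤ φ.manBits) (hq1 : ψ.qexp + 1 ≤ φ.qexp) : DRSqrt φ ψ := fun a ha => by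
  rw [← toRat_roundNE_sqrtSurr (show ψ.qexp ≤ φ.qexp by omega) ha]
  show (roundNE φ (roundNE ψ (sqrtSurr ψ a.toRat)).toRat).toRat = _
  rcases ha.eq_or_lt with h0 | hpos
  · rw [← h0, sqrtSurr_zero, toRat_roundNE_zero]
  · by_cases hex : ((sqrtCell ψ a.toRat : ℚ) * (ψ.quantum / 2)) ^ 2 = a.toRat
    · exact drSqrt_pos hE hm hU h1 hq1 hpos (n := sqrtCell ψ a.toRat)
        (Or.inl ⟨sqrtSurr_of_sq_eq hex, hex⟩)
    · exact drSqrt_pos hE hm hU h1 hq1 hpos (n := sqrtCell ψ a.toRat)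
        (Or.inr ⟨sqrtSurr_of_sq_ne hex, (sqrtCell_sq_le ha).lt_of_ne hex, lt_sqrtCell_succ_sq _⟩)

/-- The test is sound for EVERY pair of records. [this packet] -/
theorem drSqrt_of_test {φ ψ : Format} (h : drSqrtTest φ ψ = true) : DRSqrt φ ψ := by
  simp only [drSqrtTest, Bool.or_eq_true, Bool.and_eq_true, decide_eq_true_eq] at h
  rcases h with (rfl | ⟨⟨⟨hm, he⟩, hb⟩, hM⟩) | ⟨⟨⟨⟨hE, hm⟩, hU⟩, h1⟩, hq1⟩
  · exact drSqrt_self _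
  · exact drSqrt_of_sameGrid hm he hb hM
  · exact drSqrt_of_clause hE hm hU h1 hq1

/-! ## §2 Cell forms -/

/-- Cell form (I)/(G)/(S): the test holds. -/
theorem sqCellT {X Y : Format} (h : drSqrtTest X Y = true) (hm : (X, Y) ∈ drSqrtPairs) :
    DRSqrt X Y ↔ (X, Y) ∈ drSqrtPairs := iff_of_true (drSqrt_of_test h) hm

/-- Cell form (E): exhaustion of the source format. -/
theorem sqCellE {X Y : Format} (h : drSqrtExh X Y = true) (hm : (X, Y) ∈ drSqrtPairs) :
    DRSqrt X Y ↔ (X, Y) ∈ drSqrtPairs := iff_of_true (drSqrt_of_exh h) hm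

/-- Cell form (W): a failing pair, by its tabulated witness operand. -/
theorem sqCellW {X Y : Format} (h0 : 0 ≤ drSqrtWit X Y)
    (h : (roundNE X (roundNESqrt Y (roundNE X (drSqrtWit X Y)).toRat).toRat).toRat
      ≠ (roundNESqrt X (roundNE X (drSqrtWit X Y)).toRat).toRat)
    (hm : (X, Y) ∉ drSqrtPairs) : DRSqrt X Y ↔ (X, Y) ∈ drSqrtPairs :=
  iff_of_false (not_drSqrt_of_ne _ h0 h) hm

/-! ## §3 THEOREM D-sqrt on the named formats -/

set_option maxHeartbeats 8000000 in
/-- THEOREM D-sqrt (the named formats): for named `X`, `Y`, one square root in `Y` converted to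
`X` is the correctly rounded square root of `X` iff `(X, Y)` is one of the `54` pairs of
`drSqrtPairs`. Each of the `169` cells is closed by the engine its class names: the test
(I)/(G)/(S), one witness, or exhaustion of the source. -/
theorem drSqrt_named_iff {X Y : Format} (hX : X ∈ namedFormats) (hY : Y ∈ namedFormats) :
    DRSqrt X Y ↔ (X, Y) ∈ drSqrtPairs := by
  simp only [namedFormats, List.mem_cons, List.not_mem_nil, or_false] at hX hY
  rcases hX with rfl | rfl | rfl | rfl | rfl | rfl | rfl | rfl | rfl | rfl | rfl | rfl | rfl <;>
  rcases hY with rfl | rfl | rfl | rfl | rfl | rfl | rfl | rfl | rfl | rfl | rfl | rfl | rfl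
  all_goals first
    | exact sqCellT (by decide +kernel) (by decide +kernel)
    | exact sqCellW (by decide +kernel) (by decide +kernel) (by decide +kernel)
    | exact sqCellE (by decide +kernel) (by decide +kernel)

/-- THEOREM D-sqrt AS ONE BOOLEAN EVALUATION PLUS THIRTEEN NAMED CELLS: for named `X`, `Y`,
`DRSqrt X Y ↔ drSqrtTest X Y ∨ (X, Y) ∈ drSqrtExhPairs`. -/
theorem drSqrt_named_iff_test {X Y : Format} (hX : X ∈ namedFormats) (hY : Y ∈ namedFormats) :
    DRSqrt X Y ↔ drSqrtTest X Y = true ∨ (X, Y) ∈ drSqrtExhPairs := by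
  rw [drSqrt_named_iff hX hY, drSqrtPairs_eq_filter, List.mem_filter, Bool.or_eq_true,
    decide_eq_true_eq]
  exact ⟨fun h => h.2, fun h => ⟨mem_namedPairs hX hY, h⟩⟩

/-- Corollary: an innocuous square root does NOT need `F_X ⊆ F_Y` — e4m3's roots are correctly
emulated through binary8p4 and conversely, although neither value set contains the other. -/
theorem drSqrt_not_embeds : DRSqrt E4M3 Binary8p4 ∧ DRSqrt Binary8p4 E4M3 ∧
    ¬ Embeds E4M3 Binary8p4 ∧ ¬ Embeds Binary8p4 E4M3 :=
  ⟨(drSqrt_named_iff (by decide) (by decide)).mpr (by decide),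
    (drSqrt_named_iff (by decide) (by decide)).mpr (by decide),
    fun h => absurd ((embeds_named_iff (by decide) (by decide)).mp h) (by decide +kernel),
    fun h => absurd ((embeds_named_iff (by decide) (by decide)).mp h) (by decide +kernel)⟩

/-! ### Readings (kernel instances; statements about the formats' arithmetic only) -/

/-- Through binary32 every named narrower format's square root is correctly emulated by ONE wide
square root converted back; through binary16 every FP8 record's except binary8p5's; through
bfloat16 those of precision at most `3` … -/
example : DRSqrt E4M3 Binary32 ∧ DRSqrt E5M2 Binary32 ∧ DRSqrt Binary16 Binary32 ∧
    DRSqrt BFloat16 Binary32 ∧ DRSqrt E4M3 Binary16 ∧ DRSqrt E5M2 Binary16 ∧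
    DRSqrt Binary8p3 Binary16 ∧ DRSqrt Binary8p4 Binary16 ∧ DRSqrt E5M2 BFloat16 ∧
    DRSqrt Binary8p3 BFloat16 ∧ DRSqrt E2M1 BFloat16 :=
  ⟨drSqrt_of_test (by decide +kernel), drSqrt_of_test (by decide +kernel),
    drSqrt_of_test (by decide +kernel), drSqrt_of_test (by decide +kernel),
    drSqrt_of_test (by decide +kernel), drSqrt_of_test (by decide +kernel),
    drSqrt_of_test (by decide +kernel), drSqrt_of_test (by decide +kernel),
    drSqrt_of_test (by decide +kernel), drSqrt_of_test (by decide +kernel),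
    drSqrt_of_test (by decide +kernel)⟩

/-- … but not e4m3's or binary8p5's through bfloat16 (`√(15/256) ↦ 31/128 ↦ 1/4` against
`15/64`), nor binary8p5's through binary16, nor any FP6 root through an FP8 record, nor e2m1's
through any FP6 / FP8 record (`√3 ↦ 7/4 ↦ 2` against `3/2`). -/
example : ¬ DRSqrt E4M3 BFloat16 ∧ ¬ DRSqrt Binary8p5 BFloat16 ∧ ¬ DRSqrt Binary8p5 Binary16 ∧
    ¬ DRSqrt E2M3 E4M3 ∧ ¬ DRSqrt E3M2 Binary8p4 ∧ ¬ DRSqrt E2M1 E4M3 ∧ ¬ DRSqrt E2M1 E2M3 :=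
  ⟨fun h => absurd ((drSqrt_named_iff (by decide) (by decide)).mp h) (by decide +kernel),
    fun h => absurd ((drSqrt_named_iff (by decide) (by decide)).mp h) (by decide +kernel),
    fun h => absurd ((drSqrt_named_iff (by decide) (by decide)).mp h) (by decide +kernel),
    fun h => absurd ((drSqrt_named_iff (by decide) (by decide)).mp h) (by decide +kernel),
    fun h => absurd ((drSqrt_named_iff (by decide) (by decide)).mp h) (by decide +kernel),
    fun h => absurd ((drSqrt_named_iff (by decide) (by decide)).mp h) (by decide +kernel),
    fun h => absurd ((drSqrt_named_iff (by decide) (by decide)).mp h) (by decide +kernel)⟩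

/-! ## §4 The binary64 column -/

/-- Through the binary64 record `⟨52, 1023, 2046, 2^52 - 1⟩` (precision `53`, `L = -1074`) the
square root of EVERY named record, binary32 included (`53 ≥ 2·24 + 2`,
`2 (-1074 + 52) ≤ -149`), is correctly emulated: clause (S) in all thirteen cells.
[this packet; cite: Figueroa1995; Roux2014, Table II] -/
theorem drSqrt_binary64_column :
    ∀ X ∈ namedFormats, DRSqrt X ⟨52, 1023, 2046, 2 ^ 52 - 1, by decide⟩ := by
  intro X hX
  simp only [namedFormats, List.mem_cons, List.not_mem_nil, or_false] at hX
  rcases hX with rfl | rfl | rfl | rfl | rfl | rfl | rfl | rfl | rfl | rfl | rfl | rfl | rfl <;>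
    exact drSqrt_of_test (by decide +kernel)

/-! ## §5 The precision hypothesis is attained -/

/-- `P_Y ≥ 2 P_X + 2` IS ATTAINED (toy records of ample range, bias `8`): through
`⟨4, 8, 16, 15⟩` (`P_Y = 5 = 2 P_X + 1`, `L_Y = -11`) the root of the e2m1 value `3` slips
(`√3 ↦ 7/4 ↦ 2`, directly `3/2`); through `⟨5, 8, 16, 31⟩` (`P_Y = 6`, `L_Y = -12`) clause (S)
applies.
[this packet; cite: Figueroa1995] -/
theorem drSqrt_precision_clause_attained :
    ¬ DRSqrt E2M1 ⟨4, 8, 16, 15, by decide⟩ ∧ DRSqrt E2M1 ⟨5, 8, 16, 31, by decide⟩ :=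
  ⟨not_drSqrt_of_ne 3 (by norm_num) (by decide +kernel), drSqrt_of_test (by decide +kernel)⟩

end Summit.Ventures.CertifiedArithmetic
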